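import Literature.MathematicalPhysics.QuantumFieldTheory.Balaban1983to89.B11Eq26FirstVariation
import Literature.MathematicalPhysics.QuantumFieldTheory.Balaban1983to89.B11Eq90V0Derivative
import Literature.MathematicalPhysics.QuantumFieldTheory.Balaban1983to89.B9Eq31ActionZpow

/-!
# `Balaban1983to89.B11Eq26ExpansionZpow` — T. Bałaban, *The variational problem and background fields in renormalization group method for lattice gauge theories*, Commun. Math. Phys. **102** (1985) 277–309 [Balaban1985Variational]: (26)–(30) p. 282 WITH THE PRINTED WEIGHT `η^{d−4}` OF (5) AS AN INTEGER POWER — every dimension `d`, in particular `d = 3`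

statement-level skeleton of published theorems with citation tags; proofs where landed; nothing here is a claim about the Yang–Mills mass gap

PDF held: `paper:balaban1985-cmp102-variational-background` (journal page = PDF page + 276); p. 278 [PDF 2] ((5)) and
p. 282 [PDF 6] ((24)–(31)) re-read by this seat (lit-balaban reader/typer r08, gen 47, 2026-08-22) in the materialised
text layer; the verbatim transcription of (26)–(31) from the x2 render is in the module docstring of
`B11Eq26ActionExpansion` (r08 gen 5) and is not repeated.

CITATION HEADER (lean-in-tree rule 2026-08-18).  WHAT IS REPRODUCED: the `d`-dependent members of SKELETON rows
**B11.Eq24** (display (26)), **B11.Eq27** ((26)–(28) as the first variation) and **B11.Eq29** ((29)–(30)) of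
`HOME/lit-balaban-r08/ROWS-B11.md` — cells only, heads unchanged — ON THE INTEGER-POWER ACTION CARRIER
`B9Eq31ActionZpow.actionZ` of [5] (3.1) (seat r06 gen 18, p342252): the print's action (5) p. 278 «A(U) = A^η(U) =
Σ_{p⊂Ω₀} η^{d−4}[1 − Re tr U(∂p)], η = L^{−k}» and its expansion (26) p. 282 «A(U₁U₀) = Σ_{p⊂Ω₀} η^{d−4}[1 − Re tr
(U₁U₀)(∂p)] = A(U₀) + Σ_{p⊂Ω₀} η^{d−2} Im tr(DA)(p)U₀(∂p) + ½⟨A, ΔA⟩ + V₀(A)» are written for a general dimension `d`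
with the weight `η^{d−4}`; the pre-cell carrier `B9Eq39Adjoint.action` types that weight with the natural-number
subtraction `d - 4`, so the tree's (26)-files `B11Eq26ActionExpansion` (r08 gen 5) and `B11Eq26FirstVariation` (r08
gen 11) state every theorem that invokes [5] (3.12) under `4 ≤ d` — EMPTY at `d = 3`, the dimension of [16] =
[Balaban1985UV3] whose p. 260/(19) knit `B10Eq19LinearTerm` §5 (seat r07) consumes `expansion26_real`.  This is the
located scope note **L6-1** of the B11 second reader (`lit-balaban-r11/SECOND-READ-B11.md` §6, 2026-08-22), resolved
by the B9 owner with the zpow twin `B9Eq31ActionZpow` (`actionZ η d τ V := Σ_p (η:ℂ)^((d:ℤ)−4)·wil τ (V(∂p))`,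
`eq312_zpow` = (3.12) for EVERY `d`, bridge `actionZ_eq_action (hd : 4 ≤ d)`; recipe `INTERFACES-r06.md` §36b:
«replace `action`/`eq312` by `actionZ`/`eq312_zpow` and drop the `4 ≤ d` binder»).  THIS FILE is the B11 side of that
recipe, as a TWIN (nothing of the two (26)-files is modified — def-body guard; twenty tree files name `B11Eq26ActionExpansion`):
* §1 **`V0Z`** — `V₀(A)` DEFINED BY (26) on `actionZ` (`V₀(A) := A(U₁U₀) − A(U₀) − ⟨A, J⟩ − ½⟨A, ΔA⟩`), **`eq26_zpow`**,
  the bridge **`V0Z_eq_V0 (hd : 4 ≤ d)`** (it IS `B11Eq26ActionExpansion.V0` in the dimensions the old files cover),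
  **`V0Z_eq_sum_rem3`** — `V₀(A) = η^{d−4}Σ_p ρ_p` for EVERY `d` ([5] (3.12) = `B9Eq31ActionZpow.eq312_zpow`; `η ≠ 0`,
  tracial `τ`), **`eq26_printed_zpow`** (the linear term in the printed `Im tr` form, by (27) `B11Eq27Current.eq27`),
  **`eq30a_zpow`** `V₀(A) = Σ_p η^d V₀(A, ∂p)` and **`eq29_zpow`** `V₀(A) = V⁽³⁾(A) + V₄(A)` for every `d`, with the SAME
  per-plaquette objects `V0p`/`V3p`/`V4p` and totals `V3`/`V4` of `B11Eq26ActionExpansion` (they never involved the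
  subtraction: weights `η⁻⁴`, `η^d`) — so at `d = 3` the remainder of (26) is `η⁻¹Σ_p ρ_p = Σ_p η³V₀(A, ∂p)` as printed
  (`V0Z_three`); and **`differentiable_V0Z`** — «so V₀(A) is such [an entire] function also» (p. 282), every `d`, from
  the per-plaquette `B11Eq90V0Derivative.differentiable_V0p`.
* §2 «the expansion of V₀(A) begins with a third order polynomial», every `d`: **`norm_V0Z_le`**, **`norm_V0Z_le_cubic`**
  (`‖V₀(A)‖ ≦ |η|^{d−4}Σ_p ½‖τ‖(‖U₀(∂p)‖ + ‖U₀(∂p)⁻¹‖)·T₃(|η|s_p)`, `T₃(t) ≦ (t³/6)eᵗ`, integer power), **`norm_V0Z_smul_le`**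
  (`‖V₀(tA)‖ ≦ ‖t‖³K(A)`, `‖t‖ ≦ 1`), **`norm_V0Z_le_cube`** (`∃ K ≧ 0, ‖A‖ ≦ 1 → ‖V₀(A)‖ ≦ K‖A‖³`),
  **`hasFDerivAt_V0Z_zero`**.
* §3 (26)–(28) AS THE FIRST VARIATION, every `d`: **`hasFDerivAt_actionZ_prodCfg`** (`(δ/δA)A(U₁U₀)|_{A=0} = ⟨·, J⟩`),
  **`expansion26_zpow`** (`A(U₁U₀) = A(U₀) + φ(A) + q(A)`, `φ = ⟨·, J⟩` continuous linear, `HasFDerivAt q 0 0`),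
  **`expansion26_real_zpow`** — the REAL form `f(A) = Re A(exp iη(A − D̃A)·U₀) = f(0) + φ_ℝ(A − D̃A) + q(A)` with
  `φ_ℝ = Re⟨·, J⟩`, `HasFDerivAt q 0 0`, for any `D̃` with `D̃(0) = 0`, `D̃′(0) = 0`: LITERALLY the hypotheses `h26`/`hq` of
  `B10Eq19LinearTerm.inner_J_eq_zero_of_expansion26`, now available at `d = 3` (r07 re-bases §5 of that file on it at
  their discretion; §6 of `B11Eq26FirstVariation` — `bondPair_J_eq_zero_on` — never carried `4 ≤ d`).
* §4 sanity: at `d = 3` the statements are not vacuous (`V0Z_three`, two `example`s).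
Proofs: the (26)-files' proofs verbatim in substance, `eq312_zpow`/`zpow` bookkeeping in place of `eq312`/`pow_sub₀`;
the two [folklore] calculus helpers of `B11Eq26FirstVariation` §1 are private there and are re-proved here (private).

DICTIONARY.  As in `B11Eq26ActionExpansion`/`B11Eq26FirstVariation` (nothing re-declared): `𝔸` a complete normed
`ℂ`-algebra (the `N × N` matrices), sites `S`, directions `ι` (finite, ordered), bijective shifts `T`, background
`U₀ ↦ U : ι → S → 𝔸ˣ` (arbitrary units, EXACT), bond field `A : ι → S → 𝔸` of the complexified Lie algebra with the sup
(`Pi`) norm, `U₁U₀ ↦ prodCfg U η A`, `A(·) ↦ actionZ T η d τ` ((5)/(3.1) with `(η:ℂ)^((d:ℤ)−4)`), `⟨A, J⟩ ↦ bondPair η d τ A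
(J T U η)`, `⟨A, ΔA⟩ ↦ hessPair T U η d τ A`, «tr» ↦ a tracial `ℂ`-linear `τ` (continuous where norms are taken),
`Σ_{p⊂Ω₀}` ↦ the sum over `posPlaq S ι`, `|A|(∂p)` ↦ `size (lettersA T U A μ ν x)`; `η ≠ 0` wherever (3.12) is invoked.

HONEST SCOPE — what is NOT claimed.  (i) The carrier is [5]'s abstract finite lattice with an abstract tracial `τ`;
the identification with `T_η ∩ Ω₀`, `η = L^{−k}`, the normalised matrix trace and the domains of (1)–(7) is the
reader's, exactly as in `B9Eq39Adjoint`/`B9Eq31ActionZpow` (DIVERGENCE D-pv27.4 inherited).  (ii) The complexified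
`Re tr` reading of [5] p. 391 as in the (26)-files; the letter-for-letter form `eq26_printed_zpow` needs Hermitian `A`,
a unitary background and a `*`-trace.  (iii) The constants `K` of §2–§3 are existential (finite lattice).  (iv) Nothing
of (31)–(40), of the variational problem, Theorem 1 or Propositions 2–9 is touched; no row head changes (B11.Eq24,
B11.Eq27, B11.Eq29 keep their status; this file widens the typed scope of their Lean cells from `4 ≤ d` to every `d`).
(v) Not summit progress.

Depends on (BY NAME): `B9Eq31ActionZpow` (`actionZ`, `actionZ_eq_action`, `actionZ_three`, `eq312_zpow`),
`B9Eq39Adjoint` (`action`, `prodCfg`, `bondPair`, `J`, `hessPair`, `rem3`, `posPlaq`, `plaqU`, `lettersA`, `curlη`,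
`wil`, `norm_rem3_le`), `B9Eq369Product` (`prodCfg_zero`), `B11Eq26ActionExpansion` (`V0`, `V0p`, `V3`, `V4`, `eq30b`,
`lettersA_smul`), `B11Eq26FirstVariation` (`size_lettersA_le`, `exists_clm_bondPair`, `hasFDerivAt_hessPair_zero`),
`B11Eq27Current` (`eq27`), `B11Eq90V0Derivative` (`differentiable_V0p`), `Beta.TransportVertices` (`expTail`,
`expTail_three_le`, `size`, `size_nonneg`, `size_map_smul`).
-/

noncomputable section

open NormedSpace Complex Finset Filter Topology Asymptotics

namespace Literature.MathematicalPhysics.QuantumFieldTheory.Balaban1983to89.B11Eq26ExpansionZpow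

open Literature.MathematicalPhysics.QuantumFieldTheory.Balaban1983to89.Beta.TransportVertices
open Literature.MathematicalPhysics.QuantumFieldTheory.Balaban1983to89.Beta.AdjointTransportJets
open Literature.MathematicalPhysics.QuantumFieldTheory.Balaban1983to89.B9Eq37Insertion
open Literature.MathematicalPhysics.QuantumFieldTheory.Balaban1983to89.B9Eq39Adjoint
open B9Eq31ActionZpow (actionZ actionZ_eq_action actionZ_three eq312_zpow)
open B11Eq26ActionExpansion (V0 V0p V3p V4p V3 V4 eq30b lettersA_smul)
open B11Eq26FirstVariation (size_lettersA_le exists_clm_bondPair hasFDerivAt_hessPair_zero)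

/-! ## §1 (26), (29), (30) on the integer-power action `actionZ`, every `d` -/

section Lattice

variable {𝔸 : Type*} [NormedRing 𝔸] [NormedAlgebra ℂ 𝔸] [CompleteSpace 𝔸]
variable {S : Type*} [Fintype S] {ι : Type*} [Fintype ι] [LinearOrder ι]
variable (T : ι → Equiv.Perm S) (U : ι → S → 𝔸ˣ)

/-- **`V₀(A)` DEFINED BY (26) ON THE PRINTED ACTION (5)** (weight `η^{d−4}` as an integer power, every `d`):
`V₀(A) := A(U₁U₀) − A(U₀) − ⟨A, J⟩ − ½⟨A, ΔA⟩`, `U₁ = exp iηA`, `A(·) = B9Eq31ActionZpow.actionZ`; the twin of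
`B11Eq26ActionExpansion.V0` (natural-number exponent), equal to it for `4 ≤ d` (`V0Z_eq_V0`).
[cite: Balaban1985Variational, (26) p.282, (5) p.278] -/
def V0Z (η : ℝ) (d : ℕ) (τ : 𝔸 →ₗ[ℂ] ℂ) (A : ι → S → 𝔸) : ℂ :=
  actionZ T η d τ (prodCfg U η A) - actionZ T η d τ U - bondPair η d τ A (J T U η) - 2⁻¹ * hessPair T U η d τ A

/-- **(26), EVERY `d`**: `A(U₁U₀) = A(U₀) + ⟨A, J⟩ + ½⟨A, ΔA⟩ + V₀(A)` for the integer-power action.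
[cite: Balaban1985Variational, (26) p.282] -/
theorem eq26_zpow (η : ℝ) (d : ℕ) (τ : 𝔸 →ₗ[ℂ] ℂ) (A : ι → S → 𝔸) :
    actionZ T η d τ (prodCfg U η A)
      = actionZ T η d τ U + bondPair η d τ A (J T U η) + 2⁻¹ * hessPair T U η d τ A + V0Z T U η d τ A := by
  unfold V0Z
  ring

/-- **BRIDGE**: for `4 ≤ d` the integer-power `V₀` IS `B11Eq26ActionExpansion.V0` (`B9Eq31ActionZpow.actionZ_eq_action`)
— nothing changes for the existing consumers of `V0`. [cite: Balaban1985Variational, (26) p.282] -/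
theorem V0Z_eq_V0 (η : ℝ) {d : ℕ} (hd : 4 ≤ d) (τ : 𝔸 →ₗ[ℂ] ℂ) (A : ι → S → 𝔸) :
    V0Z T U η d τ A = V0 T U η d τ A := by
  simp only [V0Z, V0, actionZ_eq_action T η hd]

/-- **V₀ IS THE THIRD-ORDER TAYLOR REMAINDER, EVERY `d`** («the expansion of V₀(A) begins with a third order
polynomial»): `V₀(A) = η^{d−4}Σ_p ρ_p` with [5]'s per-plaquette third-order remainder `ρ_p = B9Eq39Adjoint.rem3` and the
integer power — (3.12) of [5] for every `d` (`B9Eq31ActionZpow.eq312_zpow`); no `4 ≤ d`.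
[cite: Balaban1985Variational, (26) p.282] [cite: Balaban1985BackgroundPropagators, (3.12) p.392] -/
theorem V0Z_eq_sum_rem3 (τ : 𝔸 →ₗ[ℂ] ℂ) (hτ : ∀ a b : 𝔸, τ (a * b) = τ (b * a)) (η : ℝ) (hη : η ≠ 0) (d : ℕ)
    (A : ι → S → 𝔸) :
    V0Z T U η d τ A = (η : ℂ) ^ ((d : ℤ) - 4) * ∑ q ∈ posPlaq S ι, rem3 T U η τ A q.2.1 q.2.2 q.1 := by
  unfold V0Z
  rw [eq312_zpow T U τ hτ η hη d A]
  ring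

/-- **AT `d = 3`** (the dimension of [16]): `V₀(A) = η⁻¹Σ_p ρ_p` — the printed weight `η^{d−4} = η⁻¹`, which the
natural-number exponent of `B11Eq26ActionExpansion.V0` cannot express. [cite: Balaban1985Variational, (26) p.282, (5) p.278] -/
theorem V0Z_three (τ : 𝔸 →ₗ[ℂ] ℂ) (hτ : ∀ a b : 𝔸, τ (a * b) = τ (b * a)) (η : ℝ) (hη : η ≠ 0)
    (A : ι → S → 𝔸) :
    V0Z T U η 3 τ A = ((η : ℂ)⁻¹) * ∑ q ∈ posPlaq S ι, rem3 T U η τ A q.2.1 q.2.2 q.1 := by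
  rw [V0Z_eq_sum_rem3 T U τ hτ η hη 3 A]
  simp only [Nat.cast_ofNat, show ((3 : ℤ) - 4) = -1 by norm_num, zpow_neg, zpow_one]

/-- **(26) LETTER FOR LETTER, EVERY `d`**: for a HERMITIAN `A`, a UNITARY background (`U(b)⁻¹ = U(b)*`) and a tracial
`*`-compatible `τ`, `A(U₁U₀) = A(U₀) + Σ_p η^{d−2} Im tr(DA)(p)U₀(∂p) + ½⟨A, ΔA⟩ + V₀(A)` on the integer-power action —
the linear term in the printed `Im tr` form, converted by (27) (`B11Eq27Current.eq27`).
[cite: Balaban1985Variational, (26)-(27) p.282] -/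
theorem eq26_printed_zpow [StarRing 𝔸] [StarModule ℂ 𝔸] (hU : ∀ μ x, (((U μ x)⁻¹ : 𝔸ˣ) : 𝔸) = star (U μ x : 𝔸))
    (τ : 𝔸 →ₗ[ℂ] ℂ) (hτ : ∀ a b : 𝔸, τ (a * b) = τ (b * a)) (hτs : ∀ a : 𝔸, τ (star a) = starRingEnd ℂ (τ a))
    (η : ℝ) (d : ℕ) {A : ι → S → 𝔸} (hA : ∀ μ x, star (A μ x) = A μ x) :
    actionZ T η d τ (prodCfg U η A)
      = actionZ T η d τ U
        + (η : ℂ) ^ d * ∑ q ∈ posPlaq S ι, ((η : ℂ)⁻¹) ^ 2 *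
            (((τ (curlη T U η A q.2.1 q.2.2 q.1 * (plaqU T U q.2.1 q.2.2 q.1 : 𝔸))).im : ℝ) : ℂ)
        + 2⁻¹ * hessPair T U η d τ A + V0Z T U η d τ A := by
  obtain ⟨h1, h2⟩ := B11Eq27Current.eq27 T U hU τ hτ hτs η d hA
  rw [h1, h2]
  exact eq26_zpow T U η d τ A

/-- `η^{d−4} = η^d·η⁻⁴` with the INTEGER power, `η ≠ 0`, every `d` (the (26)/(30) bookkeeping without `4 ≤ d`).
[cite: Balaban1985Variational, (26) p.282, (30) p.282 (bookkeeping ours)] -/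
theorem zpow_sub_four {η : ℝ} (hη : η ≠ 0) (d : ℕ) :
    (η : ℂ) ^ ((d : ℤ) - 4) = (η : ℂ) ^ d * ((η : ℂ)⁻¹) ^ 4 := by
  have hη' : (η : ℂ) ≠ 0 := Complex.ofReal_ne_zero.2 hη
  rw [zpow_sub₀ hη', zpow_natCast, div_eq_mul_inv, ← inv_zpow]
  norm_cast

/-- **(30), first display, EVERY `d`**: `V₀(A) = Σ_p η^d V₀(A, ∂p)` with the SAME per-plaquette `V₀(A, ∂p) = η⁻⁴ρ_p` of
`B11Eq26ActionExpansion` (`V0p`). [cite: Balaban1985Variational, (30) p.282] -/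
theorem eq30a_zpow (τ : 𝔸 →ₗ[ℂ] ℂ) (hτ : ∀ a b : 𝔸, τ (a * b) = τ (b * a)) (η : ℝ) (hη : η ≠ 0) (d : ℕ)
    (A : ι → S → 𝔸) :
    V0Z T U η d τ A = ∑ q ∈ posPlaq S ι, (η : ℂ) ^ d * V0p T U η τ A q.2.1 q.2.2 q.1 := by
  rw [V0Z_eq_sum_rem3 T U τ hτ η hη d A, zpow_sub_four hη d, Finset.mul_sum]
  refine Finset.sum_congr rfl fun q _ => ?_
  simp only [V0p]
  ring

/-- **(29), EVERY `d`**: `V₀(A) = V⁽³⁾(A) + V₄(A)` with the SAME totals `V⁽³⁾ = Σ_p η^d V⁽³⁾(A, ∂p)`, `V₄ = Σ_p η^d V₄(A, ∂p)`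
of `B11Eq26ActionExpansion` (`V3`, `V4`; per plaquette (30) `eq30b`). [cite: Balaban1985Variational, (29)-(30) p.282] -/
theorem eq29_zpow (τ : 𝔸 →ₗ[ℂ] ℂ) (hτ : ∀ a b : 𝔸, τ (a * b) = τ (b * a)) (η : ℝ) (hη : η ≠ 0) (d : ℕ)
    (A : ι → S → 𝔸) :
    V0Z T U η d τ A = V3 T U η d τ A + V4 T U η d τ A := by
  rw [eq30a_zpow T U τ hτ η hη d A, V3, V4, ← Finset.sum_add_distrib]
  refine Finset.sum_congr rfl fun q _ => ?_
  rw [eq30b, mul_add]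

/-- **`V₀(A)` IS AN ENTIRE FUNCTION OF `A`, EVERY `d`** (p. 282: «The action A(U₁U₀) is an analytic, and even an entire
function of A …, so V₀(A) is such a function also»), for `V0Z` — by (30) `eq30a_zpow` from the per-plaquette statement
`B11Eq90V0Derivative.differentiable_V0p` (the tree's `differentiable_V0` carries `4 ≤ d` through `eq30a`).
[cite: Balaban1985Variational, p.282, (26) p.282, (30) p.282] -/
theorem differentiable_V0Z (τ : 𝔸 →L[ℂ] ℂ) (hτ : ∀ a b : 𝔸, τ (a * b) = τ (b * a)) (η : ℝ) (hη : η ≠ 0) (d : ℕ) :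
    Differentiable ℂ (fun A : ι → S → 𝔸 => V0Z T U η d (τ : 𝔸 →ₗ[ℂ] ℂ) A) := by
  have e : (fun A : ι → S → 𝔸 => V0Z T U η d (τ : 𝔸 →ₗ[ℂ] ℂ) A)
      = fun A => ∑ q ∈ posPlaq S ι, (η : ℂ) ^ d * V0p T U η (τ : 𝔸 →ₗ[ℂ] ℂ) A q.2.1 q.2.2 q.1 := by
    funext A; exact eq30a_zpow T U (τ : 𝔸 →ₗ[ℂ] ℂ) hτ η hη d A
  rw [e]
  refine Differentiable.fun_sum fun q _ => ?_
  exact (B11Eq90V0Derivative.differentiable_V0p T U η τ q.2.1 q.2.2 q.1).const_mul _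

/-! ## §2 «The expansion of V₀(A) begins with a third order polynomial», every `d` -/

/-- THE WHOLE REMAINDER, EVERY `d`: `‖V₀(A)‖ ≦ |η|^{d−4}Σ_p ½‖τ‖(‖U₀(∂p)‖ + ‖U₀(∂p)⁻¹‖)·T₃(|η|·Σ_b‖A′(b)‖)` (integer power;
`B9Eq39Adjoint.norm_rem3_le` per plaquette) — third order in `A`. [cite: Balaban1985Variational, (26) p.282] -/
theorem norm_V0Z_le (τ : 𝔸 →L[ℂ] ℂ) (hτ : ∀ a b : 𝔸, τ (a * b) = τ (b * a)) (η : ℝ) (hη : η ≠ 0) (d : ℕ)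
    (A : ι → S → 𝔸) :
    ‖V0Z T U η d (τ : 𝔸 →ₗ[ℂ] ℂ) A‖
      ≤ |η| ^ ((d : ℤ) - 4) * ∑ q ∈ posPlaq S ι,
          2⁻¹ * ‖τ‖ * (‖(plaqU T U q.2.1 q.2.2 q.1 : 𝔸)‖ + ‖(((plaqU T U q.2.1 q.2.2 q.1)⁻¹ : 𝔸ˣ) : 𝔸)‖)
            * expTail 3 (|η| * size (lettersA T U A q.2.1 q.2.2 q.1)) := by
  rw [V0Z_eq_sum_rem3 T U (τ : 𝔸 →ₗ[ℂ] ℂ) hτ η hη d A, norm_mul, norm_zpow, Complex.norm_real, Real.norm_eq_abs]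
  refine mul_le_mul_of_nonneg_left ((norm_sum_le _ _).trans (Finset.sum_le_sum fun q _ => ?_))
    (zpow_nonneg (abs_nonneg η) _)
  exact norm_rem3_le T U τ η A q.2.1 q.2.2 q.1

/-- The CUBIC form of `norm_V0Z_le` (`T₃(t) ≦ (t³/6)eᵗ`), every `d`. [cite: Balaban1985Variational, (26) p.282] -/
theorem norm_V0Z_le_cubic (τ : 𝔸 →L[ℂ] ℂ) (hτ : ∀ a b : 𝔸, τ (a * b) = τ (b * a)) (η : ℝ) (hη : η ≠ 0) (d : ℕ)
    (A : ι → S → 𝔸) :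
    ‖V0Z T U η d (τ : 𝔸 →ₗ[ℂ] ℂ) A‖
      ≤ |η| ^ ((d : ℤ) - 4) * ∑ q ∈ posPlaq S ι,
          2⁻¹ * ‖τ‖ * (‖(plaqU T U q.2.1 q.2.2 q.1 : 𝔸)‖ + ‖(((plaqU T U q.2.1 q.2.2 q.1)⁻¹ : 𝔸ˣ) : 𝔸)‖)
            * ((|η| * size (lettersA T U A q.2.1 q.2.2 q.1)) ^ 3 / 6
                * Real.exp (|η| * size (lettersA T U A q.2.1 q.2.2 q.1))) := by
  refine (norm_V0Z_le T U τ hτ η hη d A).trans ?_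
  have hz : 0 ≤ |η| ^ ((d : ℤ) - 4) := zpow_nonneg (abs_nonneg η) _
  refine mul_le_mul_of_nonneg_left (Finset.sum_le_sum fun q _ => ?_) hz
  have hs : 0 ≤ |η| * size (lettersA T U A q.2.1 q.2.2 q.1) := mul_nonneg (abs_nonneg η) (size_nonneg _)
  exact mul_le_mul_of_nonneg_left (expTail_three_le hs) (by positivity)

/-- **«THE EXPANSION OF V₀(A) BEGINS WITH A THIRD ORDER POLYNOMIAL»**, every `d`, as a statement about the entire
function `t ↦ V₀(tA)`: `‖V₀(tA)‖ ≦ ‖t‖³·K(A)` for `‖t‖ ≦ 1`, `K(A) = |η|^{d−4}Σ_p ½‖τ‖(‖U₀(∂p)‖ + ‖U₀(∂p)⁻¹‖)((|η|s_p)³/6)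
e^{|η|s_p}`, `s_p = Σ_{b⊂∂p}‖A′(b)‖` (integer power). [cite: Balaban1985Variational, (26) p.282] -/
theorem norm_V0Z_smul_le (τ : 𝔸 →L[ℂ] ℂ) (hτ : ∀ a b : 𝔸, τ (a * b) = τ (b * a)) (η : ℝ) (hη : η ≠ 0) (d : ℕ)
    (A : ι → S → 𝔸) {t : ℂ} (ht : ‖t‖ ≤ 1) :
    ‖V0Z T U η d (τ : 𝔸 →ₗ[ℂ] ℂ) (t • A)‖
      ≤ ‖t‖ ^ 3 * (|η| ^ ((d : ℤ) - 4) * ∑ q ∈ posPlaq S ι,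
          2⁻¹ * ‖τ‖ * (‖(plaqU T U q.2.1 q.2.2 q.1 : 𝔸)‖ + ‖(((plaqU T U q.2.1 q.2.2 q.1)⁻¹ : 𝔸ˣ) : 𝔸)‖)
            * ((|η| * size (lettersA T U A q.2.1 q.2.2 q.1)) ^ 3 / 6
                * Real.exp (|η| * size (lettersA T U A q.2.1 q.2.2 q.1)))) := by
  have hz : 0 ≤ |η| ^ ((d : ℤ) - 4) := zpow_nonneg (abs_nonneg η) _
  have key : ∀ q ∈ posPlaq S ι,
      2⁻¹ * ‖τ‖ * (‖(plaqU T U q.2.1 q.2.2 q.1 : 𝔸)‖ + ‖(((plaqU T U q.2.1 q.2.2 q.1)⁻¹ : 𝔸ˣ) : 𝔸)‖)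
          * ((|η| * size (lettersA T U (t • A) q.2.1 q.2.2 q.1)) ^ 3 / 6
              * Real.exp (|η| * size (lettersA T U (t • A) q.2.1 q.2.2 q.1)))
        ≤ ‖t‖ ^ 3 * (2⁻¹ * ‖τ‖ * (‖(plaqU T U q.2.1 q.2.2 q.1 : 𝔸)‖ + ‖(((plaqU T U q.2.1 q.2.2 q.1)⁻¹ : 𝔸ˣ) : 𝔸)‖)
          * ((|η| * size (lettersA T U A q.2.1 q.2.2 q.1)) ^ 3 / 6
              * Real.exp (|η| * size (lettersA T U A q.2.1 q.2.2 q.1)))) := by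
    intro q _
    rw [lettersA_smul, size_map_smul]
    have hs : 0 ≤ size (lettersA T U A q.2.1 q.2.2 q.1) := size_nonneg _
    have h1 : ‖t‖ * size (lettersA T U A q.2.1 q.2.2 q.1) ≤ size (lettersA T U A q.2.1 q.2.2 q.1) :=
      mul_le_of_le_one_left hs ht
    have hexp : Real.exp (|η| * (‖t‖ * size (lettersA T U A q.2.1 q.2.2 q.1)))
        ≤ Real.exp (|η| * size (lettersA T U A q.2.1 q.2.2 q.1)) :=
      Real.exp_le_exp.2 (mul_le_mul_of_nonneg_left h1 (abs_nonneg η))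
    calc 2⁻¹ * ‖τ‖ * (‖(plaqU T U q.2.1 q.2.2 q.1 : 𝔸)‖ + ‖(((plaqU T U q.2.1 q.2.2 q.1)⁻¹ : 𝔸ˣ) : 𝔸)‖)
          * ((|η| * (‖t‖ * size (lettersA T U A q.2.1 q.2.2 q.1))) ^ 3 / 6
              * Real.exp (|η| * (‖t‖ * size (lettersA T U A q.2.1 q.2.2 q.1))))
        ≤ 2⁻¹ * ‖τ‖ * (‖(plaqU T U q.2.1 q.2.2 q.1 : 𝔸)‖ + ‖(((plaqU T U q.2.1 q.2.2 q.1)⁻¹ : 𝔸ˣ) : 𝔸)‖)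
          * ((|η| * (‖t‖ * size (lettersA T U A q.2.1 q.2.2 q.1))) ^ 3 / 6
              * Real.exp (|η| * size (lettersA T U A q.2.1 q.2.2 q.1))) := by gcongr
      _ = ‖t‖ ^ 3 * (2⁻¹ * ‖τ‖ * (‖(plaqU T U q.2.1 q.2.2 q.1 : 𝔸)‖ + ‖(((plaqU T U q.2.1 q.2.2 q.1)⁻¹ : 𝔸ˣ) : 𝔸)‖)
          * ((|η| * size (lettersA T U A q.2.1 q.2.2 q.1)) ^ 3 / 6
              * Real.exp (|η| * size (lettersA T U A q.2.1 q.2.2 q.1)))) := by ring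
  calc ‖V0Z T U η d (τ : 𝔸 →ₗ[ℂ] ℂ) (t • A)‖
      ≤ |η| ^ ((d : ℤ) - 4) * ∑ q ∈ posPlaq S ι,
          2⁻¹ * ‖τ‖ * (‖(plaqU T U q.2.1 q.2.2 q.1 : 𝔸)‖ + ‖(((plaqU T U q.2.1 q.2.2 q.1)⁻¹ : 𝔸ˣ) : 𝔸)‖)
            * ((|η| * size (lettersA T U (t • A) q.2.1 q.2.2 q.1)) ^ 3 / 6
                * Real.exp (|η| * size (lettersA T U (t • A) q.2.1 q.2.2 q.1))) :=
        norm_V0Z_le_cubic T U τ hτ η hη d (t • A)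
    _ ≤ |η| ^ ((d : ℤ) - 4) * ∑ q ∈ posPlaq S ι,
          ‖t‖ ^ 3 * (2⁻¹ * ‖τ‖ * (‖(plaqU T U q.2.1 q.2.2 q.1 : 𝔸)‖ + ‖(((plaqU T U q.2.1 q.2.2 q.1)⁻¹ : 𝔸ˣ) : 𝔸)‖)
            * ((|η| * size (lettersA T U A q.2.1 q.2.2 q.1)) ^ 3 / 6
                * Real.exp (|η| * size (lettersA T U A q.2.1 q.2.2 q.1)))) :=
        mul_le_mul_of_nonneg_left (Finset.sum_le_sum key) hz
    _ = _ := by rw [← Finset.mul_sum]; ring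

end Lattice

/-! ## §2 (continued): uniform cubic bound and derivative `0` at `A = 0`, every `d` -/

section Calculus

variable {𝕜 : Type*} [NontriviallyNormedField 𝕜] {E F : Type*} [NormedAddCommGroup E] [NormedSpace 𝕜 E]
  [NormedAddCommGroup F] [NormedSpace 𝕜 F]

/-- A map with `‖q(A)‖ ≦ C‖A‖²` on a ball around `0` vanishes at `0` and has Fréchet derivative `0` there
(re-proved; private in `B11Eq26FirstVariation` §1). [folklore] -/
private theorem hasFDerivAt_zero_of_norm_le_mul_sq {q : E → F} {C r : ℝ} (hr : 0 < r)
    (hq : ∀ A : E, ‖A‖ < r → ‖q A‖ ≤ C * ‖A‖ ^ 2) : HasFDerivAt q (0 : E →L[𝕜] F) 0 := by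
  have hq0 : q 0 = 0 := by
    have h := hq 0 (by rwa [norm_zero])
    rw [norm_zero, zero_pow two_ne_zero, mul_zero] at h
    exact norm_le_zero_iff.1 h
  rw [hasFDerivAt_iff_isLittleO_nhds_zero]
  simp only [zero_add, hq0, sub_zero, zero_apply]
  refine IsLittleO.of_bound fun ε hε => ?_
  have hC : 0 < max C 1 := lt_max_of_lt_right one_pos
  have hδ : 0 < min r (ε / max C 1) := lt_min hr (div_pos hε hC)
  filter_upwards [Metric.ball_mem_nhds (0 : E) hδ] with h hh
  rw [mem_ball_zero_iff, lt_min_iff] at hh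
  calc ‖q h‖ ≤ C * ‖h‖ ^ 2 := hq h hh.1
    _ ≤ max C 1 * ‖h‖ ^ 2 := mul_le_mul_of_nonneg_right (le_max_left C 1) (by positivity)
    _ = (max C 1 * ‖h‖) * ‖h‖ := by ring
    _ ≤ (max C 1 * (ε / max C 1)) * ‖h‖ := by gcongr; exact hh.2.le
    _ = ε * ‖h‖ := by field_simp

/-- The cubic case: `‖q(A)‖ ≦ C‖A‖³` for `‖A‖ ≦ 1` also gives derivative `0` at `0` (re-proved; private in
`B11Eq26FirstVariation` §1). [folklore] -/
private theorem hasFDerivAt_zero_of_norm_le_mul_cube {q : E → F} {C : ℝ} (hC : 0 ≤ C)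
    (hq : ∀ A : E, ‖A‖ ≤ 1 → ‖q A‖ ≤ C * ‖A‖ ^ 3) : HasFDerivAt q (0 : E →L[𝕜] F) 0 := by
  refine hasFDerivAt_zero_of_norm_le_mul_sq (C := C) one_pos fun A hA => (hq A hA.le).trans ?_
  have h3 : ‖A‖ ^ 3 ≤ ‖A‖ ^ 2 := pow_le_pow_of_le_one (norm_nonneg A) hA.le (by norm_num)
  exact mul_le_mul_of_nonneg_left h3 hC

end Calculus

section SecondOrder

variable {𝔸 : Type*} [NormedRing 𝔸] [NormedAlgebra ℂ 𝔸] [CompleteSpace 𝔸]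
variable {S : Type*} [Fintype S] {ι : Type*} [Fintype ι] [LinearOrder ι]
variable (T : ι → Equiv.Perm S) (U : ι → S → 𝔸ˣ)

/-- **«THE EXPANSION OF V₀(A) BEGINS WITH A THIRD ORDER POLYNOMIAL», UNIFORMLY, EVERY `d`**: `∃ K ≧ 0, ∀ A, ‖A‖ ≦ 1 →
‖V₀(A)‖ ≦ K‖A‖³` (from `norm_V0Z_le_cubic` and `B11Eq26FirstVariation.size_lettersA_le`; `K` depends on `U₀`, `η`, `τ`,
`d` and the lattice). [cite: Balaban1985Variational, (26) p.282] -/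
theorem norm_V0Z_le_cube (τ : 𝔸 →L[ℂ] ℂ) (hτ : ∀ a b : 𝔸, τ (a * b) = τ (b * a)) (η : ℝ) (hη : η ≠ 0) (d : ℕ) :
    ∃ K : ℝ, 0 ≤ K ∧ ∀ A : ι → S → 𝔸, ‖A‖ ≤ 1 → ‖V0Z T U η d (τ : 𝔸 →ₗ[ℂ] ℂ) A‖ ≤ K * ‖A‖ ^ 3 := by
  classical
  let m : S × ι × ι → ℝ := fun q =>
    2⁻¹ * ‖τ‖ * (‖(plaqU T U q.2.1 q.2.2 q.1 : 𝔸)‖ + ‖(((plaqU T U q.2.1 q.2.2 q.1)⁻¹ : 𝔸ˣ) : 𝔸)‖)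
  let c : S × ι × ι → ℝ := fun q =>
    ‖(U q.2.2 q.1 : 𝔸)‖ * ‖(((U q.2.2 q.1)⁻¹ : 𝔸ˣ) : 𝔸)‖ + 1 + 1
      + ‖(U q.2.1 q.1 : 𝔸)‖ * ‖(((U q.2.1 q.1)⁻¹ : 𝔸ˣ) : 𝔸)‖
  have hm : ∀ q, 0 ≤ m q := fun q => by positivity
  have hc : ∀ q, 0 ≤ c q := fun q => by positivity
  have hz : 0 ≤ |η| ^ ((d : ℤ) - 4) := zpow_nonneg (abs_nonneg η) _
  refine ⟨|η| ^ ((d : ℤ) - 4) * ∑ q ∈ posPlaq S ι, m q * ((|η| * c q) ^ 3 / 6 * Real.exp (|η| * c q)),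
    mul_nonneg hz (Finset.sum_nonneg fun q _ => by positivity), fun A hA => ?_⟩
  refine (norm_V0Z_le_cubic T U τ hτ η hη d A).trans ?_
  rw [mul_assoc, Finset.sum_mul]
  refine mul_le_mul_of_nonneg_left (Finset.sum_le_sum fun q _ => ?_) hz
  have hsz : size (lettersA T U A q.2.1 q.2.2 q.1) ≤ c q * ‖A‖ := size_lettersA_le T U A q.2.1 q.2.2 q.1
  have hsz1 : size (lettersA T U A q.2.1 q.2.2 q.1) ≤ c q :=
    hsz.trans (mul_le_of_le_one_right (hc q) hA)
  have hs0 : 0 ≤ size (lettersA T U A q.2.1 q.2.2 q.1) := size_nonneg _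
  have hexp : Real.exp (|η| * size (lettersA T U A q.2.1 q.2.2 q.1)) ≤ Real.exp (|η| * c q) :=
    Real.exp_le_exp.2 (mul_le_mul_of_nonneg_left hsz1 (abs_nonneg η))
  have hcube : (|η| * size (lettersA T U A q.2.1 q.2.2 q.1)) ^ 3 ≤ (|η| * (c q * ‖A‖)) ^ 3 :=
    pow_le_pow_left₀ (by positivity) (mul_le_mul_of_nonneg_left hsz (abs_nonneg η)) 3
  calc m q * ((|η| * size (lettersA T U A q.2.1 q.2.2 q.1)) ^ 3 / 6
          * Real.exp (|η| * size (lettersA T U A q.2.1 q.2.2 q.1)))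
      ≤ m q * ((|η| * (c q * ‖A‖)) ^ 3 / 6 * Real.exp (|η| * c q)) := by
        refine mul_le_mul_of_nonneg_left ?_ (hm q)
        gcongr
    _ = m q * ((|η| * c q) ^ 3 / 6 * Real.exp (|η| * c q)) * ‖A‖ ^ 3 := by ring

/-- `V₀` (integer power) has Fréchet derivative `0` at `A = 0`, every `d` («begins with a third order polynomial»).
[cite: Balaban1985Variational, (26) p.282] -/
theorem hasFDerivAt_V0Z_zero (τ : 𝔸 →L[ℂ] ℂ) (hτ : ∀ a b : 𝔸, τ (a * b) = τ (b * a)) (η : ℝ) (hη : η ≠ 0)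
    (d : ℕ) :
    HasFDerivAt (fun A : ι → S → 𝔸 => V0Z T U η d (τ : 𝔸 →ₗ[ℂ] ℂ) A) (0 : (ι → S → 𝔸) →L[ℂ] ℂ) 0 := by
  obtain ⟨K, hK0, hK⟩ := norm_V0Z_le_cube T U τ hτ η hη d
  exact hasFDerivAt_zero_of_norm_le_mul_cube hK0 hK

end SecondOrder

/-! ## §3 (26)–(28) as the first variation of the action at the background, every `d` -/

section FirstVariation

variable {𝔸 : Type*} [NormedRing 𝔸] [NormedAlgebra ℂ 𝔸] [CompleteSpace 𝔸]
variable {S : Type*} [Fintype S] {ι : Type*} [Fintype ι] [LinearOrder ι]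
variable (T : ι → Equiv.Perm S) (U : ι → S → 𝔸ˣ)

/-- **(26)–(28), EVERY `d`: `J` IS THE FIRST VARIATION OF THE WILSON ACTION (5) AT `U₀`** — the map `A ↦ A(U₁U₀)`,
`U₁ = exp iηA`, `A(·) = actionZ` (integer power), is Fréchet differentiable at `A = 0` with derivative the continuous
linear functional `A ↦ ⟨A, J⟩`; the other terms of (26) have derivative `0` at `0`.
[cite: Balaban1985Variational, (26)-(28) p.282, (5) p.278] -/
theorem hasFDerivAt_actionZ_prodCfg (τ : 𝔸 →L[ℂ] ℂ) (hτ : ∀ a b : 𝔸, τ (a * b) = τ (b * a)) (η : ℝ) (hη : η ≠ 0)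
    (d : ℕ) :
    ∃ φ : (ι → S → 𝔸) →L[ℂ] ℂ, (∀ A, φ A = bondPair η d (τ : 𝔸 →ₗ[ℂ] ℂ) A (J T U η)) ∧
      HasFDerivAt (fun A : ι → S → 𝔸 => actionZ T η d (τ : 𝔸 →ₗ[ℂ] ℂ) (prodCfg U η A)) φ 0 := by
  obtain ⟨φ, hφ⟩ := exists_clm_bondPair τ η d (J T U η)
  refine ⟨φ, hφ, ?_⟩
  have hfun : (fun A : ι → S → 𝔸 => actionZ T η d (τ : 𝔸 →ₗ[ℂ] ℂ) (prodCfg U η A))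
      = fun A => actionZ T η d (τ : 𝔸 →ₗ[ℂ] ℂ) U + φ A
          + ((2 : ℂ)⁻¹ * hessPair T U η d (τ : 𝔸 →ₗ[ℂ] ℂ) A + V0Z T U η d (τ : 𝔸 →ₗ[ℂ] ℂ) A) := by
    funext A
    rw [eq26_zpow T U η d (τ : 𝔸 →ₗ[ℂ] ℂ) A, hφ A]
    ring
  rw [hfun]
  have h2 := ((hasFDerivAt_hessPair_zero T U τ hτ η d).const_mul (2 : ℂ)⁻¹).add
    (hasFDerivAt_V0Z_zero T U τ hτ η hη d)
  have h := ((hasFDerivAt_const (actionZ T η d (τ : 𝔸 →ₗ[ℂ] ℂ) U) (0 : ι → S → 𝔸)).add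
    φ.hasFDerivAt).add h2
  exact h.congr_fderiv (by simp)

/-- **(26) IN FIRST-ORDER FORM (complex), EVERY `d`**: `A(U₁U₀) = A(U₀) + φ(A) + q(A)` for ALL `A`, with `φ = ⟨·, J⟩`
continuous linear and `q = ½⟨A, ΔA⟩ + V₀(A)` of derivative `0` at `0` (integer-power action).
[cite: Balaban1985Variational, (26)-(27) p.282] -/
theorem expansion26_zpow (τ : 𝔸 →L[ℂ] ℂ) (hτ : ∀ a b : 𝔸, τ (a * b) = τ (b * a)) (η : ℝ) (hη : η ≠ 0) (d : ℕ) :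
    ∃ (φ : (ι → S → 𝔸) →L[ℂ] ℂ) (q : (ι → S → 𝔸) → ℂ),
      (∀ A, φ A = bondPair η d (τ : 𝔸 →ₗ[ℂ] ℂ) A (J T U η)) ∧ HasFDerivAt q (0 : (ι → S → 𝔸) →L[ℂ] ℂ) 0 ∧
      ∀ A, actionZ T η d (τ : 𝔸 →ₗ[ℂ] ℂ) (prodCfg U η A)
        = actionZ T η d (τ : 𝔸 →ₗ[ℂ] ℂ) U + φ A + q A := by
  obtain ⟨φ, hφ⟩ := exists_clm_bondPair τ η d (J T U η)
  refine ⟨φ, fun A => (2 : ℂ)⁻¹ * hessPair T U η d (τ : 𝔸 →ₗ[ℂ] ℂ) A + V0Z T U η d (τ : 𝔸 →ₗ[ℂ] ℂ) A, hφ,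
    ?_, fun A => ?_⟩
  · have h2 := ((hasFDerivAt_hessPair_zero T U τ hτ η d).const_mul (2 : ℂ)⁻¹).add
      (hasFDerivAt_V0Z_zero T U τ hτ η hη d)
    exact h2.congr_fderiv (by simp)
  · rw [eq26_zpow T U η d (τ : 𝔸 →ₗ[ℂ] ℂ) A, hφ A]
    ring

/-- **(26) IN THE REAL FIRST-ORDER FORM USED ON p. 260 OF [Balaban1985UV3], EVERY `d` (so at `d = 3`, the dimension
there)**: for any map `D̃` of the bond-field space with `D̃(0) = 0` and `D̃′(0) = 0`, the REAL function
`f(A) = Re A(exp iη(A − D̃A)·U₀)` (integer-power action) satisfies, for all `A`, `f(A) = f(0) + φ_ℝ(A − D̃A) + q(A)` with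
`φ_ℝ = Re⟨·, J⟩` a continuous `ℝ`-linear functional and `HasFDerivAt q 0 0` — the hypotheses `h26`, `hq` of
`B10Eq19LinearTerm.inner_J_eq_zero_of_expansion26`, without `4 ≤ d`.
[cite: Balaban1985Variational, (26)-(27) p.282] [cite: Balaban1985UV3, p.260 (before (19))] -/
theorem expansion26_real_zpow (τ : 𝔸 →L[ℂ] ℂ) (hτ : ∀ a b : 𝔸, τ (a * b) = τ (b * a)) (η : ℝ) (hη : η ≠ 0)
    (d : ℕ) {Dt : (ι → S → 𝔸) → (ι → S → 𝔸)} (hDt0 : Dt 0 = 0)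
    (hDt : HasFDerivAt Dt (0 : (ι → S → 𝔸) →L[ℝ] (ι → S → 𝔸)) 0) :
    ∃ (φ : (ι → S → 𝔸) →L[ℝ] ℝ) (q : (ι → S → 𝔸) → ℝ),
      (∀ v, φ v = (bondPair η d (τ : 𝔸 →ₗ[ℂ] ℂ) v (J T U η)).re) ∧ HasFDerivAt q (0 : (ι → S → 𝔸) →L[ℝ] ℝ) 0 ∧
      ∀ A, (actionZ T η d (τ : 𝔸 →ₗ[ℂ] ℂ) (prodCfg U η (A - Dt A))).re
        = (actionZ T η d (τ : 𝔸 →ₗ[ℂ] ℂ) (prodCfg U η (0 - Dt 0))).re + φ (A - Dt A) + q A := by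
  obtain ⟨φ, q, hφ, hq, h26⟩ := expansion26_zpow T U τ hτ η hη d
  refine ⟨Complex.reCLM.comp (φ.restrictScalars ℝ), fun A => (q (A - Dt A)).re, fun v => by simp [hφ v], ?_,
    fun A => ?_⟩
  · -- chain rule: `A ↦ A − D̃A` has derivative `id` at `0` and value `0`; `q` has derivative `0` at `0`; then `Re`.
    have hh : HasFDerivAt (fun A : ι → S → 𝔸 => A - Dt A)
        ((ContinuousLinearMap.id ℝ (ι → S → 𝔸)) - 0) 0 := (hasFDerivAt_id (𝕜 := ℝ) (0 : ι → S → 𝔸)).sub hDt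
    have hh0 : (fun A : ι → S → 𝔸 => A - Dt A) 0 = 0 := by simp [hDt0]
    have hqR : HasFDerivAt q ((0 : (ι → S → 𝔸) →L[ℂ] ℂ).restrictScalars ℝ) ((fun A : ι → S → 𝔸 => A - Dt A) 0) := by
      rw [hh0]; exact hq.restrictScalars ℝ
    have hcomp := (Complex.reCLM.hasFDerivAt.comp _ (hqR.comp (0 : ι → S → 𝔸) hh))
    have hfeq : (fun A : ι → S → 𝔸 => (q (A - Dt A)).re)
        = (⇑Complex.reCLM ∘ q ∘ fun A : ι → S → 𝔸 => A - Dt A) := by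
      funext A; simp
    rw [hfeq]
    exact hcomp.congr_fderiv (by ext v; simp)
  · rw [h26 (A - Dt A), hDt0, sub_zero, B9Eq369Product.prodCfg_zero]
    simp

end FirstVariation

/-! ## §4 Sanity: at `d = 3` the statements are not vacuous -/

section Examples

variable {𝔸 : Type*} [NormedRing 𝔸] [NormedAlgebra ℂ 𝔸] [CompleteSpace 𝔸]
variable {S : Type*} [Fintype S] {ι : Type*} [Fintype ι] [LinearOrder ι]
variable (T : ι → Equiv.Perm S) (U : ι → S → 𝔸ˣ)

/-- At `d = 3` (26) reads `Σ_p η⁻¹ wil τ (U₁U₀)(∂p) = Σ_p η⁻¹ wil τ U₀(∂p) + ⟨A, J⟩ + ½⟨A, ΔA⟩ + V₀(A)` with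
`V₀(A) = η⁻¹Σ_p ρ_p` — both weights `η⁻¹` as printed. -/
example (τ : 𝔸 →ₗ[ℂ] ℂ) (hτ : ∀ a b : 𝔸, τ (a * b) = τ (b * a)) (η : ℝ) (hη : η ≠ 0) (A : ι → S → 𝔸) :
    ∑ q ∈ posPlaq S ι, ((η : ℂ)⁻¹) * wil τ (plaqU T (prodCfg U η A) q.2.1 q.2.2 q.1)
      = ∑ q ∈ posPlaq S ι, ((η : ℂ)⁻¹) * wil τ (plaqU T U q.2.1 q.2.2 q.1)
        + bondPair η 3 τ A (J T U η) + 2⁻¹ * hessPair T U η 3 τ A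
        + ((η : ℂ)⁻¹) * ∑ q ∈ posPlaq S ι, rem3 T U η τ A q.2.1 q.2.2 q.1 := by
  have h := eq26_zpow T U η 3 τ A
  rw [actionZ_three, actionZ_three, V0Z_three T U τ hτ η hη A] at h
  exact h

/-- At `d = 3` the first variation of the action at the background exists and is `⟨·, J⟩` (the B10/p. 260 input). -/
example (τ : 𝔸 →L[ℂ] ℂ) (hτ : ∀ a b : 𝔸, τ (a * b) = τ (b * a)) (η : ℝ) (hη : η ≠ 0) :
    ∃ φ : (ι → S → 𝔸) →L[ℂ] ℂ, (∀ A, φ A = bondPair η 3 (τ : 𝔸 →ₗ[ℂ] ℂ) A (J T U η)) ∧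
      HasFDerivAt (fun A : ι → S → 𝔸 =>
        ∑ q ∈ posPlaq S ι, ((η : ℂ)⁻¹) * wil (τ : 𝔸 →ₗ[ℂ] ℂ) (plaqU T (prodCfg U η A) q.2.1 q.2.2 q.1)) φ 0 := by
  have h := hasFDerivAt_actionZ_prodCfg T U τ hτ η hη 3
  simp only [actionZ_three] at h
  exact h

end Examples

end Literature.MathematicalPhysics.QuantumFieldTheory.Balaban1983to89.B11Eq26ExpansionZpow

end
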